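import Literature.MathematicalPhysics.QuantumFieldTheory.Balaban1983to89.Node00.Record12BgRowCoClassCPMFloor
import Literature.MathematicalPhysics.QuantumFieldTheory.Balaban1983to89.Node00.CriticalOnFibreTopGuardedB

/-!
# NODE 00 — ROW P11's GUARDED [15] THEOREM-1 SENTENCE OVER A **BOND-LEVEL DETERMINING DATUM** AND A **TOP-DATA PREDICATE**: `VariationalThm1RegSepTop7MGB ∕ …CoP7MGB F N [Sup] Adm bd Dat B₃ a₀ a₁`
# — module 53-G (`Node00/Record12BgRowCoClassCPMFloor` §4) parametrised exactly as F0c parametrised module 47; the (b)-instance sentences ARE the instance `(genSetDatum F, dataSmall7PTopOf F N)` by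
# `Iff.rfl`; the pointwise accessors; and module 20's minimiser lemma «minimal over the open top class ⇒ critical on the `bd`-fibre ⇒ Prop. 8's top step» over `(bd, Dat)`

Cell `pub-ymgap`, seat `pub-ymgap-k0-s1-w1` g9 (K0⁷ **stmt-QuantumFields-20541** helper lane; (E1)∕(iii-b) work plan WORKPLAN-IIIB 27c850bec22d4efe, row S1a-C; director-ym №338 (GO on the
additive stages) ∕ №339 (ruling (α)); FLAG №16 ∕ LOCATE-HSEAM 5d3298b8d191f169; kernel road-scan ROADSCAN-IIIB-g9 53ea8804079dcb1a: of module 53-G exactly the §4 sentences, their two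
`.of_imp`, `plaqSmallOn_of_thm1RegSepTop7MG` and `regular_of_isMinimizer_classTop_of_prop8TopStepG` lie on the K0⁷ body's road).  `--kind definition --supports stmt-QuantumFields-20541`
(count-neutral).  [15] = [Balaban1985Variational]; [6] = [Balaban1985RegularSpaces]; [II] = [Balaban1984PropagatorsII]; [III] = [Balaban1988Convergent]; [I] = [Balaban1987RG1].

HONESTY GUARD (№338 (5)).  PURELY ADDITIVE: print-datum parametrisation of `Node00/Record12BgRowCoClassCPMFloor` §4 (FLAG №16 ∕ LOCATE-HSEAM 5d3298b8d191f169); the (b)-instances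
`VariationalThm1RegSepTop7MG ∕ …CoP7MG ∕ …Top7MR ∕ …CoP7MR` stay landed and true on their own text (`variationalThm1RegSepTop7MG_iff_GB` etc. below are `Iff.rfl`); NOTHING in module
53-G is edited; no displayed premise of any sentence is deleted or weakened — the data row and the minimiser's datum become PARAMETERS `(Dat, bd)` and the old rows are one instance.

WHY (LOCATE-HSEAM (γ); director-ym №339 (α)).  Module 53-G's guarded (8)-sentence for minimisers quantifies over `IsMinimizer (avOfRecord F N K) {class (6)-Top at ε₀} (genSet s.Ω k) W U₀` —
[III] (2.12) on the READING-(b) fibre (all bonds MEETING `Γ_j`) — with the data hypothesis `Sect2.DataSmall7PTop … W` read on the same bond class.  Print's Theorem 1 ∕ Prop. 8 are about the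
minimiser on the [II] (2.3) fibre «Λ_j = Ω_j^{(j)} ∖ Ω_{j+1}^{(j)} … for the sets of sites and the sets of bonds» (p. 224 — the DIFFERENCE of the bond sets; inward connectors belong to no
`Λ_j`: ruling (α) of record), whose data hypothesis (7) is read on `Λ_j`'s plaquettes (§7′ `Node00/Record12BgRowMixedDataB`).  Exactly as F0c (`Node00/CriticalOnFibreTopGuardedB`) did for the
STEP token `Prop8RegSepTopStepG`, this file makes the datum reading of the (8)-SENTENCE an instantiation: the minimiser row reads `IsMinimizerB (avOfRecord F N K) {…} (bd K k s.Ω) W U₀` for a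
bond-datum family `bd : BondDatum F` (F0a `IsMinimizerB`), the data row reads `Dat K s.Ω (Sup ν K s.Ω) k δ W` for `Dat : TopData F N`.  The (b)-road is the instance `(genSetDatum F,
dataSmall7PTopOf F N)` (`Iff.rfl`: `IsMinimizer … 𝔹 = IsMinimizerB … (bondsDet 𝔹)` is F0a `isMinimizer_iff_isMinimizerB`, definitional); print's road is `bd := lamDatum F` with the (7)
predicate of the print datum (§7′'s `Sect2.DataSmall7LamTop`, plugged in as `Dat` by its consumer — this file does not wait for it).  The one place where module 53-G does more than THREAD the
rows is §3∕§4's minimiser lemma («minimal over the OPEN class ⇒ critical on the fibre», [15] (6) p. 278 + Fermat): over a bond datum this is F0b's `deriv_wilsonAction4_eq_zero_of_isMinimizerB`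
with module 20's curve-openness `eventually_mem_classTop` — three lines, re-proved here pointwise (no new name for the lemma is declared in this file; dag-n07-w2's S1b-2 names it).

WHAT IS HERE (sorry-free; TWO definitions (named facts, `Prop`s, never asserted) + bookkeeping + one three-line Fermat step).
* §1 `VariationalThm1RegSepTop7MGB F N Sup Adm bd Dat B₃ a₀ a₁` ∕ `VariationalThm1RegSepCoP7MGB F N Adm bd Dat B₃ a₀ a₁` (module 53-G §4's bodies with the two rows parametrised, every
  other byte identical); ★ `variationalThm1RegSepTop7MG_iff_GB ∕ …CoP7MG_iff_GB` (module 53-G's guarded sentences ARE the instance `(genSetDatum F) (dataSmall7PTopOf F N)`, `Iff.rfl`),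
  `variationalThm1RegSepTop7MR_iff_GB_floorGuard ∕ …CoP7MR_iff_GB_floorGuard` (53-G §1's floor editions = the instance at `Adm := floorGuard F c`, `Iff.rfl`), `.toCoP7MGB ∕ .toTop7MGB`,
  `.of_le` (antitone in `a₀ a₁`), `.of_imp` (antitone in the guard), `.of_imp_dat` (antitone in the data predicate), `.and_right ∕ .and_left` (guards compose by conjunction).
* §2 the pointwise accessors `plaqSmallOn_of_thm1RegSepTop7MGB ∕ coDivSmallOn_of_thm1RegSepTop7MGB` (53-G §4's, over `(bd, Dat)`).
* §3 ★ `regular_of_isMinimizerB_classTop_of_prop8TopStepGB` — Theorem 1's (8) for `bd`-minimisers at a genuine step from F0c's `Prop8RegSepTopStepGB` at the same `(Sup, Adm, bd, Dat)`;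
  ★★ `variationalThm1RegSepTop7MGB_of_prop8RegSepTopStepGB_of_zero` ∕ `…CoP7MGB_…` — the (8)-SENTENCE from the STEP token, given the step-`0` clause as a displayed hypothesis (the
  `k = 0` flat case is Summits-side, module 53's `…N07Thm1Top7FromProp8Guarded`; its `(bd, Dat)` twin supplies `h0` and obtains the sentence by this door with no further term).
NOT HERE: the record-level accessors at node00-def-R's collar-class background `UbgMSCoPOfRecord` (53-G §2's `plaqSmallOn_UbgMSCoPOfRecord_of_thm1RegSepCoP7MR` …) — they key on the
Stage-2 restated spec (`isMinimizer(B)_UbgMSCoPOfRecord` at print's datum) and ride in the row-body sequel; the (9) gauge sentences over `(bd, Dat)` (dag-n07-w2 S1b-2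
`Node00/Record12BgRowCoClassGaugeRGuardedB`); the (7) predicate of the print datum (§7′); the V23 stub texts (plan).
HONEST SCOPE.  Definitions of named facts + binder-threading bookkeeping + the elementary Fermat step; nothing of [15]'s analysis asserted or proved; no (b)-instance fact is claimed false
(FLAG №16 concerns which instance print PROVES); `stub_prop8StepCoPGridG13` ∕ K0⁷ NOT closed; N07 NOT discharged; counts unmoved (typed 28∕28 · discharged 8∕28); one finite 𝕋⁴ programme
at fixed ε — the route closes the conditional finite-𝕋⁴ rung `BalabanLadder.UV` only; nothing continuum ∕ ℝ⁴ ∕ OS; the Yang–Mills mass gap (Clay) is NOT proved by any of this.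
No `sorry`, no `instance`, no `notation`.

References: [15] (1)–(2) p.277–278, (6)–(7) p.278, Thm 1 (8) p.279, p.299 (Fermat), p.304 lines 1–2, Prop. 8 p.304; [6] (1.3)–(1.9) p.77; [II] (2.3) p.224; [III] p.255, (2.6)–(2.8)
pp.255–256, (2.10)–(2.12) p.256; [I] (0.1) p.251.
-/

noncomputable section

open MeasureTheory
open scoped Matrix.Norms.L2Operator

namespace Literature.MathematicalPhysics.QuantumFieldTheory.Balaban1983to89.Node00

open Filter Topology
open T4Continuum (T4Family)
open B15DeterminingSets B15DeterminingSetsB B12RegularSpaces111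

/-! ## §1  The guarded (8)-sentences over `(bd, Dat)` and their API -/

section NamedFactTopMGB

variable (F : T4Family) (N : ℕ) [NeZero N]

/-- **[15] THEOREM 1 ((8) for minimisers over class (6) on a top domain), GUARD-GENERIC, OVER A BOND DATUM AND A TOP-DATA PREDICATE**: module 53-G's `VariationalThm1RegSepTop7MG` with the
data row `Dat K s.Ω (Sup ν K s.Ω) k δ W` and the minimiser row `IsMinimizerB (avOfRecord F N K) {class (6)-Top at ε₀} (bd K k s.Ω) W U₀`; every other byte identical.  A `Prop` with
parameters, NEVER asserted; the K0 skeleton names a CONCRETE guard and datum (never free ones).  Print-datum parametrisation of `VariationalThm1RegSepTop7MG` (FLAG №16 ∕ LOCATE-HSEAM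
5d3298b8d191f169); the (b)-instance `VariationalThm1RegSepTop7MG` stays landed and true on its own text (`variationalThm1RegSepTop7MG_iff_GB`).
[cite: Balaban1985Variational, Thm 1 (2),(6),(7)–(8) pp.278–279, p.304 lines 1–2; Balaban1985RegularSpaces, (1.3)–(1.9) p.77; Balaban1984PropagatorsII, (2.3) p.224; Balaban1988Convergent, (2.10)–(2.12) p.256; Balaban1987RG1, (0.1) p.251] -/
def VariationalThm1RegSepTop7MGB (Sup : (ν : Stage7Numerics) → (K : ℕ) → (ℕ → Set (Site (F.P K) 0)) → Set (Site (F.P K) 0)) (Adm : StepGuard F) (bd : BondDatum F) (Dat : TopData F N)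
    (B₃ a₀ a₁ : ℝ) : Prop :=
  ∀ (ν : Stage7Numerics) (M : ℕ) (g : ℕ → ℝ) (K k : ℕ) (s : SeqOfRecord F ν M g K k), Sect2.SeqSeparated ν.M₁ s → 0 < ν.M₁ → Adm ν M g K k s → ∀ (ε₀ : ℝ) (δ : ℕ → ℝ),
    (∀ n, n ≤ k → 0 < δ n ∧ δ n ≤ a₁ ∧ B₃ * δ n ≤ ε₀) → (∀ n, n < k → δ n ≤ 2 * δ (n + 1)) → (∀ n, n < k → δ (n + 1) ≤ 2 * δ n) → ε₀ ≤ a₀ →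
    ∀ W : MSField (F.P K) (SU N), Dat K s.Ω (Sup ν K s.Ω) k δ W →
      ∀ U₀, IsMinimizerB (avOfRecord F N K)
          {U | (∀ n, n ≤ k → PlaqSmallOn (Sect2.omegaPlaqsTop s.Ω (Sup ν K s.Ω) n) (ε₀ * (F.P K).eta n ^ 2) U) ∧
            Sect2.CoDivClassOnTop s.Ω (Sup ν K s.Ω) k ε₀ U} (bd K k s.Ω) W U₀ →
        (∀ n, n ≤ k → PlaqSmallOn (Sect2.omegaPlaqsTop s.Ω (Sup ν K s.Ω) n) (B₃ * δ n * (F.P K).eta n ^ 2) U₀) ∧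
          ∀ n, n ≤ k → Sect2.CoDivSmallOn (Sect2.omegaBondsTop s.Ω (Sup ν K s.Ω) n) (B₃ * δ n * (F.P K).eta n ^ 3) U₀

/-- **THE `CoP` EDITION OVER `(bd, Dat)`**: §1's sentence at node00-def-R's selector `Sup := suppDomOfRecord` (module 53-G's `VariationalThm1RegSepCoP7MG` with the two rows parametrised).
[cite: Balaban1985Variational, Thm 1 (7)–(8) pp.278–279, p.304 lines 1–2; Balaban1985RegularSpaces, (1.3)–(1.6) p.77; Balaban1984PropagatorsII, (2.3) p.224; Balaban1988Convergent, p.255, (2.12) p.256] -/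
def VariationalThm1RegSepCoP7MGB (Adm : StepGuard F) (bd : BondDatum F) (Dat : TopData F N) (B₃ a₀ a₁ : ℝ) : Prop :=
  VariationalThm1RegSepTop7MGB F N (fun ν K Ω => suppDomOfRecord F ν K Ω) Adm bd Dat B₃ a₀ a₁

variable {F N}

/-! ### The instances of record: module 53-G's sentences, by `Iff.rfl` -/

/-- ★ Module 53-G's `VariationalThm1RegSepTop7MG` IS the instance `(genSetDatum F) (dataSmall7PTopOf F N)` — definitionally (`IsMinimizer … 𝔹 = IsMinimizerB … (bondsDet 𝔹)`, F0a).
[cite: Balaban1985Variational, Thm 1 (8) p.279; Balaban1988Convergent, (2.10)–(2.12) p.256; Balaban1987RG1, (0.1) p.251] -/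
theorem variationalThm1RegSepTop7MG_iff_GB {Sup : (ν : Stage7Numerics) → (K : ℕ) → (ℕ → Set (Site (F.P K) 0)) → Set (Site (F.P K) 0)} {Adm : StepGuard F} {B₃ a₀ a₁ : ℝ} :
    VariationalThm1RegSepTop7MG F N Sup Adm B₃ a₀ a₁ ↔ VariationalThm1RegSepTop7MGB F N Sup Adm (genSetDatum F) (dataSmall7PTopOf F N) B₃ a₀ a₁ := Iff.rfl

/-- ★ Module 53-G's `VariationalThm1RegSepCoP7MG` IS the instance `(genSetDatum F) (dataSmall7PTopOf F N)`, definitionally. [cite: Balaban1985Variational, Thm 1 (8) p.279; Balaban1988Convergent, (2.12) p.256] -/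
theorem variationalThm1RegSepCoP7MG_iff_GB {Adm : StepGuard F} {B₃ a₀ a₁ : ℝ} :
    VariationalThm1RegSepCoP7MG F N Adm B₃ a₀ a₁ ↔ VariationalThm1RegSepCoP7MGB F N Adm (genSetDatum F) (dataSmall7PTopOf F N) B₃ a₀ a₁ := Iff.rfl

/-- Module 53-G §1's FLOOR-CARRYING sentence `VariationalThm1RegSepTop7MR … c …` IS the instance `(floorGuard F c) (genSetDatum F) (dataSmall7PTopOf F N)`, definitionally.
[cite: Balaban1985Variational, Thm 1 (8) p.279, p.304 lines 1–2; Balaban1985RegularSpaces, (1.3)–(1.6) p.77] -/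
theorem variationalThm1RegSepTop7MR_iff_GB_floorGuard {Sup : (ν : Stage7Numerics) → (K : ℕ) → (ℕ → Set (Site (F.P K) 0)) → Set (Site (F.P K) 0)} {c : ℕ} {B₃ a₀ a₁ : ℝ} :
    VariationalThm1RegSepTop7MR F N Sup c B₃ a₀ a₁ ↔ VariationalThm1RegSepTop7MGB F N Sup (floorGuard F c) (genSetDatum F) (dataSmall7PTopOf F N) B₃ a₀ a₁ := Iff.rfl

/-- Module 53-G §1's `VariationalThm1RegSepCoP7MR … c …` IS the instance `(floorGuard F c) (genSetDatum F) (dataSmall7PTopOf F N)`, definitionally.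
[cite: Balaban1985Variational, Thm 1 (8) p.279, p.304 lines 1–2; Balaban1985RegularSpaces, (1.3)–(1.6) p.77] -/
theorem variationalThm1RegSepCoP7MR_iff_GB_floorGuard {c : ℕ} {B₃ a₀ a₁ : ℝ} :
    VariationalThm1RegSepCoP7MR F N c B₃ a₀ a₁ ↔ VariationalThm1RegSepCoP7MGB F N (floorGuard F c) (genSetDatum F) (dataSmall7PTopOf F N) B₃ a₀ a₁ := Iff.rfl

/-! ### Bridges `Top ↔ CoP` and the API -/

/-- Definitional bridge (`CoP` ⇒ `Top` at the selector of record). [cite: Balaban1985Variational, Thm 1 (8) p.279 (bookkeeping)] -/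
theorem VariationalThm1RegSepCoP7MGB.toTop7MGB {Adm : StepGuard F} {bd : BondDatum F} {Dat : TopData F N} {B₃ a₀ a₁ : ℝ}
    (h : VariationalThm1RegSepCoP7MGB F N Adm bd Dat B₃ a₀ a₁) : VariationalThm1RegSepTop7MGB F N (fun ν K Ω => suppDomOfRecord F ν K Ω) Adm bd Dat B₃ a₀ a₁ := h

/-- Conversely (definitional). [cite: Balaban1985Variational, Thm 1 (8) p.279 (bookkeeping)] -/
theorem VariationalThm1RegSepTop7MGB.toCoP7MGB {Adm : StepGuard F} {bd : BondDatum F} {Dat : TopData F N} {B₃ a₀ a₁ : ℝ}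
    (h : VariationalThm1RegSepTop7MGB F N (fun ν K Ω => suppDomOfRecord F ν K Ω) Adm bd Dat B₃ a₀ a₁) : VariationalThm1RegSepCoP7MGB F N Adm bd Dat B₃ a₀ a₁ := h

/-- Antitone in the ceilings `a₀ a₁` (the letters enter only as the ceilings `ε₀ ≤ a₀`, `δ_n ≤ a₁`). [cite: Balaban1985Variational, Thm 1 p.279 (the range «ε₀ ≤ a₀», «ε₁ ≤ a₁»)] -/
theorem VariationalThm1RegSepTop7MGB.of_le {Sup : (ν : Stage7Numerics) → (K : ℕ) → (ℕ → Set (Site (F.P K) 0)) → Set (Site (F.P K) 0)} {Adm : StepGuard F} {bd : BondDatum F}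
    {Dat : TopData F N} {B₃ a₀ a₀' a₁ a₁' : ℝ} (h : VariationalThm1RegSepTop7MGB F N Sup Adm bd Dat B₃ a₀ a₁) (ha₀ : a₀' ≤ a₀) (ha₁ : a₁' ≤ a₁) :
    VariationalThm1RegSepTop7MGB F N Sup Adm bd Dat B₃ a₀' a₁' :=
  fun ν M g K k s hsep hM₁ hadm ε₀ δ hnum hcomp hcomp' hε W h7 U₀ hmin =>
    h ν M g K k s hsep hM₁ hadm ε₀ δ (fun n hn => ⟨(hnum n hn).1, (hnum n hn).2.1.trans ha₁, (hnum n hn).2.2⟩) hcomp hcomp' (hε.trans ha₀) W h7 U₀ hmin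

/-- ANTITONE IN THE GUARD: a stronger guard `Adm′ ⇒ Adm` asks the sentence of fewer prefixes. [cite: Balaban1985Variational, Thm 1 (8) p.279 (bookkeeping)] -/
theorem VariationalThm1RegSepTop7MGB.of_imp {Sup : (ν : Stage7Numerics) → (K : ℕ) → (ℕ → Set (Site (F.P K) 0)) → Set (Site (F.P K) 0)} {Adm Adm' : StepGuard F} {bd : BondDatum F}
    {Dat : TopData F N} {B₃ a₀ a₁ : ℝ} (h : VariationalThm1RegSepTop7MGB F N Sup Adm bd Dat B₃ a₀ a₁) (himp : ∀ ν M g K k s, Adm' ν M g K k s → Adm ν M g K k s) :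
    VariationalThm1RegSepTop7MGB F N Sup Adm' bd Dat B₃ a₀ a₁ :=
  fun ν M g K k s hsep hM₁ hadm' => h ν M g K k s hsep hM₁ (himp ν M g K k s hadm')

/-- ANTITONE IN THE DATA PREDICATE: a WEAKER data hypothesis `Dat′ ⇒ Dat` pointwise gives a STRONGER sentence (the door through which §7′'s `DataSmall7PTop.toLamTop`-type bridges act).
[cite: Balaban1985Variational, (7) p.278, Thm 1 (8) p.279 (bookkeeping)] -/
theorem VariationalThm1RegSepTop7MGB.of_imp_dat {Sup : (ν : Stage7Numerics) → (K : ℕ) → (ℕ → Set (Site (F.P K) 0)) → Set (Site (F.P K) 0)} {Adm : StepGuard F} {bd : BondDatum F}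
    {Dat Dat' : TopData F N} {B₃ a₀ a₁ : ℝ} (h : VariationalThm1RegSepTop7MGB F N Sup Adm bd Dat B₃ a₀ a₁)
    (himp : ∀ (K : ℕ) (Ω : ℕ → Set (Site (F.P K) 0)) (Ω₀ : Set (Site (F.P K) 0)) (k : ℕ) (δ : ℕ → ℝ) (W : MSField (F.P K) (SU N)), Dat' K Ω Ω₀ k δ W → Dat K Ω Ω₀ k δ W) :
    VariationalThm1RegSepTop7MGB F N Sup Adm bd Dat' B₃ a₀ a₁ :=
  fun ν M g K k s hsep hM₁ hadm ε₀ δ hnum hcomp hcomp' hε W h7 => h ν M g K k s hsep hM₁ hadm ε₀ δ hnum hcomp hcomp' hε W (himp _ _ _ _ _ _ h7)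

/-- Guards compose by conjunction: a sentence guarded by `Adm₁` serves the guard `Adm₁ ∧ Adm₂`. [cite: Balaban1985Variational, Thm 1 (8) p.279 (bookkeeping)] -/
theorem VariationalThm1RegSepTop7MGB.and_right {Sup : (ν : Stage7Numerics) → (K : ℕ) → (ℕ → Set (Site (F.P K) 0)) → Set (Site (F.P K) 0)} {Adm₁ Adm₂ : StepGuard F} {bd : BondDatum F}
    {Dat : TopData F N} {B₃ a₀ a₁ : ℝ} (h : VariationalThm1RegSepTop7MGB F N Sup Adm₁ bd Dat B₃ a₀ a₁) :
    VariationalThm1RegSepTop7MGB F N Sup (fun ν M g K k s => Adm₁ ν M g K k s ∧ Adm₂ ν M g K k s) bd Dat B₃ a₀ a₁ :=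
  h.of_imp fun _ _ _ _ _ _ h' => h'.1

/-- Guards compose by conjunction (left factor added). [cite: Balaban1985Variational, Thm 1 (8) p.279 (bookkeeping)] -/
theorem VariationalThm1RegSepTop7MGB.and_left {Sup : (ν : Stage7Numerics) → (K : ℕ) → (ℕ → Set (Site (F.P K) 0)) → Set (Site (F.P K) 0)} {Adm₁ Adm₂ : StepGuard F} {bd : BondDatum F}
    {Dat : TopData F N} {B₃ a₀ a₁ : ℝ} (h : VariationalThm1RegSepTop7MGB F N Sup Adm₂ bd Dat B₃ a₀ a₁) :
    VariationalThm1RegSepTop7MGB F N Sup (fun ν M g K k s => Adm₁ ν M g K k s ∧ Adm₂ ν M g K k s) bd Dat B₃ a₀ a₁ :=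
  h.of_imp fun _ _ _ _ _ _ h' => h'.2

/-- The `CoP` edition is antitone in `a₀ a₁`. [cite: Balaban1985Variational, Thm 1 p.279 (bookkeeping)] -/
theorem VariationalThm1RegSepCoP7MGB.of_le {Adm : StepGuard F} {bd : BondDatum F} {Dat : TopData F N} {B₃ a₀ a₀' a₁ a₁' : ℝ}
    (h : VariationalThm1RegSepCoP7MGB F N Adm bd Dat B₃ a₀ a₁) (ha₀ : a₀' ≤ a₀) (ha₁ : a₁' ≤ a₁) : VariationalThm1RegSepCoP7MGB F N Adm bd Dat B₃ a₀' a₁' :=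
  VariationalThm1RegSepTop7MGB.of_le h ha₀ ha₁

/-- The `CoP` edition is antitone in the guard. [cite: Balaban1985Variational, Thm 1 (8) p.279 (bookkeeping)] -/
theorem VariationalThm1RegSepCoP7MGB.of_imp {Adm Adm' : StepGuard F} {bd : BondDatum F} {Dat : TopData F N} {B₃ a₀ a₁ : ℝ}
    (h : VariationalThm1RegSepCoP7MGB F N Adm bd Dat B₃ a₀ a₁) (himp : ∀ ν M g K k s, Adm' ν M g K k s → Adm ν M g K k s) :
    VariationalThm1RegSepCoP7MGB F N Adm' bd Dat B₃ a₀ a₁ :=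
  VariationalThm1RegSepTop7MGB.of_imp h himp

/-- The `CoP` edition is antitone in the data predicate. [cite: Balaban1985Variational, (7) p.278, Thm 1 (8) p.279 (bookkeeping)] -/
theorem VariationalThm1RegSepCoP7MGB.of_imp_dat {Adm : StepGuard F} {bd : BondDatum F} {Dat Dat' : TopData F N} {B₃ a₀ a₁ : ℝ}
    (h : VariationalThm1RegSepCoP7MGB F N Adm bd Dat B₃ a₀ a₁)
    (himp : ∀ (K : ℕ) (Ω : ℕ → Set (Site (F.P K) 0)) (Ω₀ : Set (Site (F.P K) 0)) (k : ℕ) (δ : ℕ → ℝ) (W : MSField (F.P K) (SU N)), Dat' K Ω Ω₀ k δ W → Dat K Ω Ω₀ k δ W) :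
    VariationalThm1RegSepCoP7MGB F N Adm bd Dat' B₃ a₀ a₁ :=
  VariationalThm1RegSepTop7MGB.of_imp_dat h himp

/-- A floor-carrying (b)-instance `CoP` sentence serves every guard implying its floor, at the (b)-instance (53-G's `…CoP7MR.toG_of_imp_floor` in the `(bd, Dat)` currency).
[cite: Balaban1985RegularSpaces, (1.3)–(1.6) p.77 (bookkeeping)] -/
theorem VariationalThm1RegSepCoP7MR.toGB_of_imp_floor {c : ℕ} {Adm : StepGuard F} {B₃ a₀ a₁ : ℝ} (h : VariationalThm1RegSepCoP7MR F N c B₃ a₀ a₁)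
    (himp : ∀ ν M g K k s, Adm ν M g K k s → c ≤ ν.M₁) : VariationalThm1RegSepCoP7MGB F N Adm (genSetDatum F) (dataSmall7PTopOf F N) B₃ a₀ a₁ :=
  (variationalThm1RegSepCoP7MR_iff_GB_floorGuard.1 h).of_imp himp

end NamedFactTopMGB

/-! ## §2  The pointwise accessors over `(bd, Dat)` -/

section AccessorsGB

variable {F : T4Family} {N : ℕ} [NeZero N]

/-- **EVERY `bd`-MINIMISER OVER THE TOP-DOMAIN CLASS (6) AT THE RECORD's LETTERS IS `B₃·cR·ε_n`-REGULAR (plaquettes), UNDER ANY GUARD, FOR DATA SATISFYING `Dat`** — 53-G §4's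
`plaqSmallOn_of_thm1RegSepTop7MG` over `(bd, Dat)`. [cite: Balaban1985Variational, Thm 1 (2),(6)–(8) pp.278–279; Balaban1985RegularSpaces, (1.3) p.77; Balaban1988Convergent, (2.6)–(2.8) pp.255–256, (2.12) p.256] -/
theorem plaqSmallOn_of_thm1RegSepTop7MGB {Sup : (ν : Stage7Numerics) → (K : ℕ) → (ℕ → Set (Site (F.P K) 0)) → Set (Site (F.P K) 0)} {Adm : StepGuard F} {bd : BondDatum F}
    {Dat : TopData F N} {B₃ a₀ a₁ : ℝ} (h15 : VariationalThm1RegSepTop7MGB F N Sup Adm bd Dat B₃ a₀ a₁) (ν : Stage7Numerics) (M : ℕ)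
    (g : ℕ → ℝ) (K k : ℕ) (cR : ℝ) (s : SeqOfRecord F ν M g K k) (hsep : Sect2.SeqSeparated ν.M₁ s) (hM₁ : 0 < ν.M₁) (hadm : Adm ν M g K k s)
    (hnum : ∀ n, n ≤ k → 0 < cR * epsOfRecord ν g n ∧ cR * epsOfRecord ν g n ≤ a₁ ∧ B₃ * (cR * epsOfRecord ν g n) ≤ ν.εreg) (ha₀ : ν.εreg ≤ a₀)
    (hcomp : ∀ n, n < k → cR * epsOfRecord ν g n ≤ 2 * (cR * epsOfRecord ν g (n + 1)))
    (hcomp' : ∀ n, n < k → cR * epsOfRecord ν g (n + 1) ≤ 2 * (cR * epsOfRecord ν g n))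
    {W : MSField (F.P K) (SU N)} (h7 : Dat K s.Ω (Sup ν K s.Ω) k (fun n => cR * epsOfRecord ν g n) W)
    {U₀ : GaugeField (F.P K) 0 (SU N)} (hmin : IsMinimizerB (avOfRecord F N K)
      {U | (∀ n, n ≤ k → PlaqSmallOn (Sect2.omegaPlaqsTop s.Ω (Sup ν K s.Ω) n) (ν.εreg * (F.P K).eta n ^ 2) U) ∧
        Sect2.CoDivClassOnTop s.Ω (Sup ν K s.Ω) k ν.εreg U} (bd K k s.Ω) W U₀) :
    ∀ n, n ≤ k → PlaqSmallOn (Sect2.omegaPlaqsTop s.Ω (Sup ν K s.Ω) n) (B₃ * (cR * epsOfRecord ν g n) * (F.P K).eta n ^ 2) U₀ :=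
  (h15 ν M g K k s hsep hM₁ hadm ν.εreg (fun n => cR * epsOfRecord ν g n) hnum hcomp hcomp' ha₀ W h7 U₀ hmin).1

/-- The co-divergence half, under any guard, over `(bd, Dat)` — 53-G §4's `coDivSmallOn_of_thm1RegSepTop7MG`. [cite: Balaban1985Variational, Thm 1 (8) p.279; Balaban1985RegularSpaces, (1.9) p.77] -/
theorem coDivSmallOn_of_thm1RegSepTop7MGB {Sup : (ν : Stage7Numerics) → (K : ℕ) → (ℕ → Set (Site (F.P K) 0)) → Set (Site (F.P K) 0)} {Adm : StepGuard F} {bd : BondDatum F}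
    {Dat : TopData F N} {B₃ a₀ a₁ : ℝ} (h15 : VariationalThm1RegSepTop7MGB F N Sup Adm bd Dat B₃ a₀ a₁) (ν : Stage7Numerics) (M : ℕ)
    (g : ℕ → ℝ) (K k : ℕ) (cR : ℝ) (s : SeqOfRecord F ν M g K k) (hsep : Sect2.SeqSeparated ν.M₁ s) (hM₁ : 0 < ν.M₁) (hadm : Adm ν M g K k s)
    (hnum : ∀ n, n ≤ k → 0 < cR * epsOfRecord ν g n ∧ cR * epsOfRecord ν g n ≤ a₁ ∧ B₃ * (cR * epsOfRecord ν g n) ≤ ν.εreg) (ha₀ : ν.εreg ≤ a₀)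
    (hcomp : ∀ n, n < k → cR * epsOfRecord ν g n ≤ 2 * (cR * epsOfRecord ν g (n + 1)))
    (hcomp' : ∀ n, n < k → cR * epsOfRecord ν g (n + 1) ≤ 2 * (cR * epsOfRecord ν g n))
    {W : MSField (F.P K) (SU N)} (h7 : Dat K s.Ω (Sup ν K s.Ω) k (fun n => cR * epsOfRecord ν g n) W)
    {U₀ : GaugeField (F.P K) 0 (SU N)} (hmin : IsMinimizerB (avOfRecord F N K)
      {U | (∀ n, n ≤ k → PlaqSmallOn (Sect2.omegaPlaqsTop s.Ω (Sup ν K s.Ω) n) (ν.εreg * (F.P K).eta n ^ 2) U) ∧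
        Sect2.CoDivClassOnTop s.Ω (Sup ν K s.Ω) k ν.εreg U} (bd K k s.Ω) W U₀) :
    ∀ n, n ≤ k → Sect2.CoDivSmallOn (Sect2.omegaBondsTop s.Ω (Sup ν K s.Ω) n) (B₃ * (cR * epsOfRecord ν g n) * (F.P K).eta n ^ 3) U₀ :=
  (h15 ν M g K k s hsep hM₁ hadm ν.εreg (fun n => cR * epsOfRecord ν g n) hnum hcomp hcomp' ha₀ W h7 U₀ hmin).2

end AccessorsGB

/-! ## §3  Module 20's minimiser lemma and the (8)-sentence from F0c's step token, over `(bd, Dat)` -/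

section MinimiserGB

variable {F : T4Family} {N : ℕ} [NeZero N]

/-- ★ **THEOREM 1's (8) FOR `bd`-MINIMISERS AT A GENUINE STEP, FROM PROPOSITION 8's GUARD-GENERIC TOP STEP OVER `(bd, Dat)`** — module 53-G's
`regular_of_isMinimizer_classTop_of_prop8TopStepG` with F0c's `h8 : Prop8RegSepTopStepGB F N Sup Adm bd Dat …` and the minimiser row `IsMinimizerB … (bd K k s.Ω) W U₀`: minimal over the
OPEN top class ([6] (1.7)∧(1.9) are strict inequalities, module 20's `eventually_mem_classTop`) ⇒ critical on the `bd`-fibre (F0b's Fermat step `deriv_wilsonAction4_eq_zero_of_isMinimizerB`)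
⇒ Prop. 8's top step at this prefix.  Pointwise in `(W, U₀)`; no estimate of [15] is used. [cite: Balaban1985Variational, Thm 1 (6)–(8) pp.278–279, p.299, Prop. 8 p.304, p.304 lines 1–2; Balaban1985RegularSpaces, (1.7)–(1.9) p.77; Balaban1988Convergent, (2.12) p.256; Balaban1984PropagatorsII, (2.3) p.224] -/
theorem regular_of_isMinimizerB_classTop_of_prop8TopStepGB {Sup : (ν : Stage7Numerics) → (K : ℕ) → (ℕ → Set (Site (F.P K) 0)) → Set (Site (F.P K) 0)}
    {Adm : StepGuard F} {bd : BondDatum F} {Dat : TopData F N} {B₃ a₀ a₁ : ℝ} (h8 : Prop8RegSepTopStepGB F N Sup Adm bd Dat B₃ a₀ a₁) (ν : Stage7Numerics) (M : ℕ)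
    (g : ℕ → ℝ) (K k : ℕ) (s : SeqOfRecord F ν M g K k) (hsep : Sect2.SeqSeparated ν.M₁ s) (hM₁ : 0 < ν.M₁) (hadm : Adm ν M g K k s) (hk : 1 ≤ k)
    (ε₀ : ℝ) (δ : ℕ → ℝ) (hδ : ∀ n, n ≤ k → 0 < δ n ∧ δ n ≤ a₁ ∧ B₃ * δ n ≤ ε₀) (hcomp : ∀ n, n < k → δ n ≤ 2 * δ (n + 1))
    (hcomp' : ∀ n, n < k → δ (n + 1) ≤ 2 * δ n) (hε₀ : ε₀ ≤ a₀)
    (W : MSField (F.P K) (SU N)) (h7 : Dat K s.Ω (Sup ν K s.Ω) k δ W) {U₀ : GaugeField (F.P K) 0 (SU N)}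
    (hU₀ : IsMinimizerB (avOfRecord F N K)
      {U | (∀ n, n ≤ k → PlaqSmallOn (Sect2.omegaPlaqsTop s.Ω (Sup ν K s.Ω) n) (ε₀ * (F.P K).eta n ^ 2) U) ∧
        Sect2.CoDivClassOnTop s.Ω (Sup ν K s.Ω) k ε₀ U} (bd K k s.Ω) W U₀) :
    (∀ n, n ≤ k → PlaqSmallOn (Sect2.omegaPlaqsTop s.Ω (Sup ν K s.Ω) n) (B₃ * δ n * (F.P K).eta n ^ 2) U₀) ∧
      ∀ n, n ≤ k → Sect2.CoDivSmallOn (Sect2.omegaBondsTop s.Ω (Sup ν K s.Ω) n) (B₃ * δ n * (F.P K).eta n ^ 3) U₀ := by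
  -- the Fermat step on the `bd`-fibre over the OPEN top class, inlined (F0b + module 20's curve-openness)
  have hcrit : IsCritOnFibreB F N K (bd K k s.Ω) W U₀ := by
    intro γ h0 hd hc a ha
    have hγ : ContinuousAt (fun t (b : PBond (F.P K) 0) => γ t b) 0 := continuousAt_of_differentiableAt_val hd
    have hU : (∀ n, n ≤ k → PlaqSmallOn (Sect2.omegaPlaqsTop s.Ω (Sup ν K s.Ω) n) (ε₀ * (F.P K).eta n ^ 2) (γ 0)) ∧
        Sect2.CoDivClassOnTop s.Ω (Sup ν K s.Ω) k ε₀ (γ 0) := by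
      rw [h0]
      exact hU₀.1
    exact deriv_wilsonAction4_eq_zero_of_isMinimizerB hU₀ h0 (eventually_mem_classTop hγ hU) hc ha
  exact h8 ν M g K k s hsep hM₁ hadm hk ε₀ δ hδ hcomp hcomp' hε₀ W h7 U₀ hU₀.1.1 hU₀.1.2 hU₀.2.1 hcrit

/-- ★★ **THE GUARDED (8)-SENTENCE FROM F0c's STEP TOKEN, OVER `(bd, Dat)`, GIVEN THE STEP-`0` CLAUSE**: `Prop8RegSepTopStepGB` serves the genuine steps `1 ≤ k` (★ above); the flat case
`k = 0` (no averaging constraint is active on the top domain's interior; the class itself bounds the minimiser once `ε₀ ≤ B₃δ₀` is NOT available — it is the Summits-side lemma of module 53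
`…N07Thm1Top7FromProp8Guarded`) is displayed here as the hypothesis `h0`, stated for `bd`-minimisers.  So the `(bd, Dat)` twin of module 53 supplies `h0` and gets the sentence by this door.
[cite: Balaban1985Variational, Thm 1 (7)–(8) pp.278–279, Prop. 8 p.304; Balaban1988Convergent, (2.12) p.256; Balaban1984PropagatorsII, (2.3) p.224] -/
theorem variationalThm1RegSepTop7MGB_of_prop8RegSepTopStepGB_of_zero {Sup : (ν : Stage7Numerics) → (K : ℕ) → (ℕ → Set (Site (F.P K) 0)) → Set (Site (F.P K) 0)}
    {Adm : StepGuard F} {bd : BondDatum F} {Dat : TopData F N} {B₃ a₀ a₁ : ℝ} (h8 : Prop8RegSepTopStepGB F N Sup Adm bd Dat B₃ a₀ a₁)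
    (h0 : ∀ (ν : Stage7Numerics) (M : ℕ) (g : ℕ → ℝ) (K : ℕ) (s : SeqOfRecord F ν M g K 0), Sect2.SeqSeparated ν.M₁ s → 0 < ν.M₁ → Adm ν M g K 0 s → ∀ (ε₀ : ℝ) (δ : ℕ → ℝ),
      (0 < δ 0 ∧ δ 0 ≤ a₁ ∧ B₃ * δ 0 ≤ ε₀) → ε₀ ≤ a₀ →
      ∀ W : MSField (F.P K) (SU N), Dat K s.Ω (Sup ν K s.Ω) 0 δ W →
        ∀ U₀, IsMinimizerB (avOfRecord F N K)
            {U | (∀ n, n ≤ 0 → PlaqSmallOn (Sect2.omegaPlaqsTop s.Ω (Sup ν K s.Ω) n) (ε₀ * (F.P K).eta n ^ 2) U) ∧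
              Sect2.CoDivClassOnTop s.Ω (Sup ν K s.Ω) 0 ε₀ U} (bd K 0 s.Ω) W U₀ →
          PlaqSmallOn (Sect2.omegaPlaqsTop s.Ω (Sup ν K s.Ω) 0) (B₃ * δ 0 * (F.P K).eta 0 ^ 2) U₀ ∧
            Sect2.CoDivSmallOn (Sect2.omegaBondsTop s.Ω (Sup ν K s.Ω) 0) (B₃ * δ 0 * (F.P K).eta 0 ^ 3) U₀) :
    VariationalThm1RegSepTop7MGB F N Sup Adm bd Dat B₃ a₀ a₁ := by
  intro ν M g K k s hsep hM₁ hadm ε₀ δ hδ hcomp hcomp' hε₀ W h7 U₀ hU₀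
  rcases Nat.eq_zero_or_pos k with hk | hk
  · subst hk
    obtain ⟨hP, hD⟩ := h0 ν M g K s hsep hM₁ hadm ε₀ δ (hδ 0 le_rfl) hε₀ W h7 U₀ hU₀
    exact ⟨fun n hn => by obtain rfl := Nat.le_zero.mp hn; exact hP, fun n hn => by obtain rfl := Nat.le_zero.mp hn; exact hD⟩
  · exact regular_of_isMinimizerB_classTop_of_prop8TopStepGB h8 ν M g K k s hsep hM₁ hadm hk ε₀ δ hδ hcomp hcomp' hε₀ W h7 hU₀

/-- The `CoP` edition of ★★ (at node00-def-R's selector `suppDomOfRecord`). [cite: Balaban1985Variational, Thm 1 (7)–(8) pp.278–279, Prop. 8 p.304; Balaban1988Convergent, p.255, (2.12) p.256] -/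
theorem variationalThm1RegSepCoP7MGB_of_prop8RegSepTopStepGB_of_zero {Adm : StepGuard F} {bd : BondDatum F} {Dat : TopData F N} {B₃ a₀ a₁ : ℝ}
    (h8 : Prop8RegSepTopStepGB F N (fun ν K Ω => suppDomOfRecord F ν K Ω) Adm bd Dat B₃ a₀ a₁)
    (h0 : ∀ (ν : Stage7Numerics) (M : ℕ) (g : ℕ → ℝ) (K : ℕ) (s : SeqOfRecord F ν M g K 0), Sect2.SeqSeparated ν.M₁ s → 0 < ν.M₁ → Adm ν M g K 0 s → ∀ (ε₀ : ℝ) (δ : ℕ → ℝ),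
      (0 < δ 0 ∧ δ 0 ≤ a₁ ∧ B₃ * δ 0 ≤ ε₀) → ε₀ ≤ a₀ →
      ∀ W : MSField (F.P K) (SU N), Dat K s.Ω (suppDomOfRecord F ν K s.Ω) 0 δ W →
        ∀ U₀, IsMinimizerB (avOfRecord F N K)
            {U | (∀ n, n ≤ 0 → PlaqSmallOn (Sect2.omegaPlaqsTop s.Ω (suppDomOfRecord F ν K s.Ω) n) (ε₀ * (F.P K).eta n ^ 2) U) ∧
              Sect2.CoDivClassOnTop s.Ω (suppDomOfRecord F ν K s.Ω) 0 ε₀ U} (bd K 0 s.Ω) W U₀ →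
          PlaqSmallOn (Sect2.omegaPlaqsTop s.Ω (suppDomOfRecord F ν K s.Ω) 0) (B₃ * δ 0 * (F.P K).eta 0 ^ 2) U₀ ∧
            Sect2.CoDivSmallOn (Sect2.omegaBondsTop s.Ω (suppDomOfRecord F ν K s.Ω) 0) (B₃ * δ 0 * (F.P K).eta 0 ^ 3) U₀) :
    VariationalThm1RegSepCoP7MGB F N Adm bd Dat B₃ a₀ a₁ :=
  variationalThm1RegSepTop7MGB_of_prop8RegSepTopStepGB_of_zero h8 h0

end MinimiserGB

end Literature.MathematicalPhysics.QuantumFieldTheory.Balaban1983to89.Node00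

end
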